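import Literature.Geometry.Riemannian.ChernTransgressionDivergence
import Literature.Geometry.Lorentzian.CoordDivergenceIdentity
import Mathlib.Analysis.InnerProductSpace.PiL2
import HarnessLib

/-!
# Dictionary between the two coordinate formalisms of a metric on `ℝᵈ`:
# bilinear-form fields on `EuclideanSpace ℝ (Fin d)` and matrix fields on `Fin d → ℝ`

The tree carries two coordinate tensor calculi of a pseudo-Riemannian metric:

* `Lorentzian/CoordCurvature.lean`, `CoordDivergenceIdentity.lean` (namespace `MetricCoord`):
  the components are a field of bilinear forms `G : E → E →L[ℝ] E →L[ℝ] ℝ` on a normed space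
  `E`, with the Christoffel map `chrAt G x`, the curvature endomorphism `riemAt G x X Y`, the
  covariant differential `covDAt G Z x` and the divergence `divAt G Z x` of a vector field
  `Z : E → E` — this is the calculus to which the abstract objects of a manifold are reduced in a
  chart (`Riemannian/CurvatureAsDivergence.lean`, `CurvatureNormSq.lean`);
* `Riemannian/ChernTransgression.lean` (Chern's transgression form and its divergence identity,
  `div_chernTransgression_eq_eulerDensity_holds`): the components are a matrix field
  `g : (Fin d → ℝ) → Matrix (Fin d) (Fin d) ℝ` with `coordChristoffel`, `coordRiemann`,
  `unitField`, `covDerivUnitField`, partial derivatives `coordPartial`.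

This file identifies them on `E = EuclideanSpace ℝ (Fin d)` through the standard basis
`eᵢ = EuclideanSpace.single i 1` and the coordinate map `ofLp : E → (Fin d → ℝ)`:
`metricMatrix G x̃ i j = G (toLp x̃) eᵢ eⱼ`, `coordField Z = ofLp ∘ Z ∘ toLp`, and PROVES, for
`G` a metric on an open set `V` (`IsMetricOn G V`),

* `coordPartial_comp_toLp` / `coordPartial_metricMatrix` — `∂ₖ` of a transported function is the
  Fréchet derivative on `eₖ`; `∂ₖ g_{ij} = DG(x)(eₖ)(eᵢ)(eⱼ)`;
* `metricMatrix_mulVec`, `metricNormSq_metricMatrix` — `(g ṽ)ₐ = G(v, eₐ)`, `ṽᵀ g ṽ = G(v,v)`;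
* `ginv_mul_metricMatrix`, `metricMatrix_inv` — the inverse matrix is `ginv G b x`
  (the coefficients of `♯ = (G x)⁻¹`);
* `coordChristoffel_metricMatrix` — **`Γⁱⱼₖ = eⁱ(Γ_x(eⱼ, eₖ))`** (O'Neill 1983, Prop. 3.13; both
  sides are `½ gⁱˡ(∂ⱼg_{lk} + ∂ₖg_{jl} − ∂ₗg_{jk})`, using the symmetry of `G` and of `DG`);
* `coordRiemannUp_metricMatrix`, **`coordRiemann_metricMatrix`** —
  `Rⁱⱼₖₗ = eⁱ(R_x(eₖ, eₗ)eⱼ)` and `Rᵢⱼₖₗ = G_x(R_x(eₖ, eₗ)eⱼ, eᵢ)` (O'Neill 1983, Lemma 3.38; same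
  convention `R(X,Y) = [∇_X, ∇_Y] − ∇_{[X,Y]}` on both sides);
* `unitField_coordField`, **`covDerivUnitField_coordField`** — the unit field and its lowered
  covariant derivative: `(∇ₖu)ₐ = G_x(∇_{eₖ} û, eₐ)` with `û = (G(Z,Z))^{-1/2} Z` and
  `∇_{eₖ} û = covDAt G û x eₖ`;
* `divAt_eq_sum_coord`, `coordPartial_sqrt_det`, **`sum_coordPartial_sqrt_det_mul`** — the
  divergence in divergence form: `∑ᵢ ∂ᵢ(√(det g) Z̃ⁱ) = √(det g) · div Z` (Lee 2018, Prop. 2.46),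
  through Jacobi's formula `∂ₖ √det g = √det g ∑ₐ Γᵃₖₐ` (`ChernSetting.coordPartial_det`,
  `sum_Γ_diag` of `ChernTransgressionDivergence.lean`), for which `chernSettingOf` packages a
  positive definite `G` and a nonvanishing `C²` field `Z` as a `ChernSetting` (the hypotheses of
  `div_chernTransgression_eq_eulerDensity`).

Everything is proved; the definitions are the two explicit transports `metricMatrix`,
`coordField` (and the unit field `metricUnitField`).

## References

* B. O'Neill, *Semi-Riemannian geometry*, Academic Press 1983, Ch. 3, Prop. 3.13 (Christoffel
  symbols), Lemma 3.38 (curvature components), p. 86 (divergence). [ONeill1983]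
* J. M. Lee, *Introduction to Riemannian Manifolds*, 2nd ed. (2018), (5.10), Prop. 7.4, (7.7),
  Prop. 2.46 (divergence in coordinates). [Lee2018]
-/

noncomputable section

set_option maxSynthPendingDepth 3

open Set Filter Finset Matrix WithLp ContinuousLinearMap
open scoped Topology ContDiff

namespace Literature.Geometry.Riemannian

open Lorentzian Lorentzian.MetricCoord

variable {d : ℕ}

/-- Local notation for the model spaces `ℝⁿ` with their Euclidean structure. -/
local notation "𝔼" n:max => EuclideanSpace ℝ (Fin n)

/-! ### The standard basis and the coordinate map -/

/-- The standard basis `eᵢ = EuclideanSpace.single i 1` of `ℝᵈ` as a `Module.Basis`. [folklore] -/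
abbrev coordBasis (d : ℕ) : Module.Basis (Fin d) ℝ (EuclideanSpace ℝ (Fin d)) :=
  (EuclideanSpace.basisFun (Fin d) ℝ).toBasis

/-- `coordBasis d i = EuclideanSpace.single i 1`. [folklore] -/
theorem stdBasis_apply (i : Fin d) : coordBasis d i = EuclideanSpace.single i (1 : ℝ) := by
  rw [coordBasis, OrthonormalBasis.coe_toBasis, EuclideanSpace.basisFun_apply]

/-- The coordinates in the standard basis are the entries: `eⁱ(v) = vᵢ`. [folklore] -/
@[simp]
theorem stdBasis_repr (v : (𝔼 d)) (i : Fin d) : (coordBasis d).repr v i = v i := by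
  rw [coordBasis, OrthonormalBasis.coe_toBasis_repr_apply, EuclideanSpace.basisFun_repr]

/-- `eⁱ(v) = vᵢ` for the coordinate functional. [folklore] -/
@[simp]
theorem stdBasis_coord (v : (𝔼 d)) (i : Fin d) : (coordBasis d).coord i v = v i := by
  rw [Module.Basis.coord_apply, stdBasis_repr]

/-- `toLp (Pi.single k 1) = eₖ`. [folklore] -/
theorem toLp_single (k : Fin d) :
    toLp 2 (Pi.single k (1 : ℝ)) = (coordBasis d k : (𝔼 d)) := by
  rw [stdBasis_apply]
  rfl

/-- The entries of `eₖ`: `(eₖ)ⱼ = δⱼₖ`. [folklore] -/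
theorem stdBasis_apply_apply (k j : Fin d) :
    (coordBasis d k : (𝔼 d)) j = if j = k then 1 else 0 := by
  rw [stdBasis_apply]
  exact PiLp.single_apply 2 ℝ k 1 j

/-- Expansion of a vector on the standard basis: `v = ∑ᵢ vᵢ eᵢ`. [folklore] -/
theorem sum_smul_stdBasis (v : (𝔼 d)) : ∑ i, v i • (coordBasis d i : (𝔼 d)) = v := by
  conv_rhs => rw [← (coordBasis d).sum_repr v]
  simp only [stdBasis_repr]

/-! ### The two transports -/

/-- **The matrix field of a bilinear-form field**: `g_{ij}(x̃) = G(toLp x̃)(eᵢ, eⱼ)` on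
`Fin d → ℝ`. [cite: ONeill1983, Ch. 3, Def. 3.1] -/
def metricMatrix (G : (𝔼 d) → (𝔼 d) →L[ℝ] (𝔼 d) →L[ℝ] ℝ) (y : Fin d → ℝ) : Matrix (Fin d) (Fin d) ℝ :=
  Matrix.of fun i j ↦ G (toLp 2 y) (coordBasis d i) (coordBasis d j)

/-- Unfolding lemma for `metricMatrix`. [folklore] -/
@[simp]
theorem metricMatrix_apply (G : (𝔼 d) → (𝔼 d) →L[ℝ] (𝔼 d) →L[ℝ] ℝ) (y : Fin d → ℝ) (i j : Fin d) :
    metricMatrix G y i j = G (toLp 2 y) (coordBasis d i) (coordBasis d j) := rfl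

/-- **A vector field transported to `Fin d → ℝ`**: `Z̃ = ofLp ∘ Z ∘ toLp`. [folklore] -/
def coordField (Z : (𝔼 d) → (𝔼 d)) (y : Fin d → ℝ) : Fin d → ℝ :=
  ofLp (Z (toLp 2 y))

/-- Unfolding lemma for `coordField`. [folklore] -/
@[simp]
theorem coordField_apply (Z : (𝔼 d) → (𝔼 d)) (y : Fin d → ℝ) (a : Fin d) :
    coordField Z y a = Z (toLp 2 y) a := rfl

/-! ### Partial derivatives of transported functions -/

/-- **`∂ₖ (f ∘ toLp)(ofLp x) = Df(x)(eₖ)`**: the coordinate partial derivative of a transported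
scalar function is the Fréchet derivative on the basis vector. [folklore] -/
theorem coordPartial_comp_toLp (f : (𝔼 d) → ℝ) (x : (𝔼 d)) (k : Fin d) :
    coordPartial k (fun y ↦ f (toLp 2 y)) (ofLp x) = fderiv ℝ f x (coordBasis d k) := by
  rw [coordPartial_def]
  have h : (fun y : Fin d → ℝ ↦ f (toLp 2 y)) = f ∘ ⇑(EuclideanSpace.equiv (Fin d) ℝ).symm := rfl
  rw [h, ContinuousLinearEquiv.comp_right_fderiv, ContinuousLinearMap.comp_apply]
  congr 1
  exact toLp_single k

/-- Differentiability of a transported scalar function. [folklore] -/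
theorem differentiableAt_comp_toLp {f : (𝔼 d) → ℝ} {x : (𝔼 d)} (hf : DifferentiableAt ℝ f x) :
    DifferentiableAt ℝ (fun y : Fin d → ℝ ↦ f (toLp 2 y)) (ofLp x) :=
  hf.comp (ofLp x) (EuclideanSpace.equiv (Fin d) ℝ).symm.differentiableAt

variable {G : (𝔼 d) → (𝔼 d) →L[ℝ] (𝔼 d) →L[ℝ] ℝ} {V : Set (𝔼 d)} {x : (𝔼 d)}

/-- **`∂ₖ g_{ij} = DG(x)(eₖ)(eᵢ)(eⱼ)`**. [folklore] -/
theorem coordPartial_metricMatrix (hG : IsMetricOn G V) (hx : x ∈ V) (k i j : Fin d) :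
    coordPartial k (fun y ↦ metricMatrix G y i j) (ofLp x) =
      fderiv ℝ G x (coordBasis d k) (coordBasis d i) (coordBasis d j) := by
  simp only [metricMatrix_apply]
  rw [coordPartial_comp_toLp (fun z ↦ G z (coordBasis d i) (coordBasis d j)) x k,
    hG.fderiv_apply₂ hx]

/-! ### Index gymnastics: lowering, the norm, the inverse matrix -/

/-- **Lowering an index**: `(g ṽ)ₐ = G_x(v, eₐ)` for `ṽ = ofLp v`. [cite: ONeill1983, Ch. 3, p. 60] -/
theorem metricMatrix_mulVec (hs : ∀ v w : (𝔼 d), G x v w = G x w v) (v : (𝔼 d)) (a : Fin d) :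
    (metricMatrix G (ofLp x) *ᵥ ofLp v) a = G x v (coordBasis d a) := by
  simp only [Matrix.mulVec, dotProduct, metricMatrix_apply, WithLp.toLp_ofLp]
  have h : G x (∑ j, v j • (coordBasis d j : (𝔼 d))) (coordBasis d a) =
      ∑ j, G x (coordBasis d a) (coordBasis d j) * ofLp v j := by
    rw [map_sum, FunLike.coe_sum, Finset.sum_apply]
    refine Finset.sum_congr rfl fun j _ ↦ ?_
    rw [map_smul, FunLike.coe_smul, Pi.smul_apply, smul_eq_mul, hs, mul_comm]
  rw [← h, sum_smul_stdBasis]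

/-- **The squared norm**: `ṽᵀ g ṽ = G_x(v, v)`. [cite: ONeill1983, Ch. 3, p. 55] -/
theorem metricNormSq_metricMatrix (hs : ∀ v w : (𝔼 d), G x v w = G x w v) (v : (𝔼 d)) :
    metricNormSq (metricMatrix G) (ofLp x) (ofLp v) = G x v v := by
  rw [metricNormSq]
  simp only [dotProduct, metricMatrix_mulVec hs]
  have h : G x v (∑ a, v a • (coordBasis d a : (𝔼 d))) = ∑ a, ofLp v a * G x v (coordBasis d a) := by
    rw [map_sum]
    refine Finset.sum_congr rfl fun a _ ↦ ?_
    rw [map_smul, smul_eq_mul]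
  rw [← h, sum_smul_stdBasis]

/-- `ginv · g = 1`: the coefficients of `♯` invert the matrix of the metric. [cite: ONeill1983, Ch. 3, Lemma 3.4] -/
theorem ginv_mul_metricMatrix (hx : (G x).IsInvertible) (hs : ∀ v w : (𝔼 d), G x v w = G x w v) :
    (Matrix.of fun i j ↦ ginv G (coordBasis d) x i j) * metricMatrix G (ofLp x) = 1 := by
  ext i k
  rw [Matrix.mul_apply, Matrix.one_apply]
  have h := coord_eq_sum_ginv (coordBasis d) hx (coordBasis d k) i
  simp only [stdBasis_coord, stdBasis_apply_apply] at h
  rw [h]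
  refine Finset.sum_congr rfl fun j _ ↦ ?_
  rw [Matrix.of_apply, metricMatrix_apply, WithLp.toLp_ofLp, hs]

/-- **The inverse matrix**: `(g(x̃))⁻¹ᵢⱼ = gⁱʲ = eⁱ(♯ eʲ)`. [cite: ONeill1983, Ch. 3, p. 60] -/
theorem metricMatrix_inv (hx : (G x).IsInvertible) (hs : ∀ v w : (𝔼 d), G x v w = G x w v)
    (i j : Fin d) : (metricMatrix G (ofLp x))⁻¹ i j = ginv G (coordBasis d) x i j := by
  have h := Matrix.inv_eq_left_inv (ginv_mul_metricMatrix hx hs)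
  rw [h, Matrix.of_apply]

/-! ### The Christoffel symbols -/

/-- **The Christoffel symbols of the matrix field are the components of the Christoffel map**:
`Γⁱⱼₖ(x̃) = eⁱ(Γ_x(eⱼ, eₖ))` — both are `½ ∑ₗ gⁱˡ(∂ⱼg_{lk} + ∂ₖg_{jl} − ∂ₗg_{jk})`
(O'Neill 1983, Prop. 3.13, with the symmetry of `G` and of `DG`). [cite: ONeill1983, Ch. 3, Prop. 3.13] -/
theorem coordChristoffel_metricMatrix (hG : IsMetricOn G V) (hx : x ∈ V) (i j k : Fin d) :
    coordChristoffel (metricMatrix G) (ofLp x) i j k =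
      (coordBasis d).coord i (chrAt G x (coordBasis d j) (coordBasis d k)) := by
  have hxi := hG.isInvertible x hx
  have hs := hG.symm x hx
  rw [chrAt_apply, map_smul, smul_eq_mul, coord_sharpAt_eq_sum (coordBasis d), coordChristoffel]
  congr 1
  refine Finset.sum_congr rfl fun l _ ↦ ?_
  rw [metricMatrix_inv hxi hs, koszulCLM_apply, coordPartial_metricMatrix hG hx,
    coordPartial_metricMatrix hG hx, coordPartial_metricMatrix hG hx,
    hG.fderiv_symm hx (coordBasis d j) (coordBasis d l) (coordBasis d k),
    hG.fderiv_symm hx (coordBasis d k) (coordBasis d j) (coordBasis d l)]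

/-- The same identity at every point of the transported open set (as functions, eventually near
`ofLp x`). [cite: ONeill1983, Ch. 3, Prop. 3.13] -/
theorem coordChristoffel_metricMatrix_eventually (hG : IsMetricOn G V) (hx : x ∈ V) (i j k : Fin d) :
    (fun y ↦ coordChristoffel (metricMatrix G) y i j k) =ᶠ[𝓝 (ofLp x)]
      fun y ↦ (coordBasis d).coord i (chrAt G (toLp 2 y) (coordBasis d j) (coordBasis d k)) := by
  have hopen : IsOpen ((fun y : Fin d → ℝ ↦ (toLp 2 y : (𝔼 d))) ⁻¹' V) :=
    hG.isOpen.preimage (EuclideanSpace.equiv (Fin d) ℝ).symm.continuous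
  filter_upwards [hopen.mem_nhds (show toLp 2 (ofLp x) ∈ V from hx)] with y hy
  have h := coordChristoffel_metricMatrix hG hy i j k
  rwa [WithLp.ofLp_toLp] at h

/-! ### The curvature -/

/-- **`Rⁱⱼₖₗ = eⁱ(R_x(eₖ, eₗ) eⱼ)`**: the mixed curvature components of the matrix field are the
components of the curvature endomorphism of the bilinear-form field (O'Neill 1983, Lemma 3.38;
`R(∂ₖ,∂ₗ)∂ⱼ = Rⁱⱼₖₗ∂ᵢ` on both sides). [cite: ONeill1983, Ch. 3, Lemma 3.38] -/
theorem coordRiemannUp_metricMatrix (hG : IsMetricOn G V) (hx : x ∈ V)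
    (i j k l : Fin d) :
    coordRiemannUp (metricMatrix G) (ofLp x) i j k l =
      (coordBasis d).coord i (riemAt G x (coordBasis d k) (coordBasis d l) (coordBasis d j)) := by
  set b := coordBasis d with hb
  have hΓd : DifferentiableAt ℝ (chrAt G) x := hG.differentiableAt_chrAt hx
  -- the derivative terms: `∂ₚ Γⁱ_{qr} = eⁱ(D_{eₚ}Γ(e_q, e_r))`
  have hder : ∀ p q r : Fin d,
      coordPartial p (fun y ↦ coordChristoffel (metricMatrix G) y i q r) (ofLp x) =
        b.coord i (fderiv ℝ (chrAt G) x (b p) (b q) (b r)) := by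
    intro p q r
    rw [coordPartial_def, (coordChristoffel_metricMatrix_eventually hG hx i q r).fderiv_eq,
      ← coordPartial_def,
      coordPartial_comp_toLp (fun z ↦ b.coord i (chrAt G z (b q) (b r))) x p]
    have h1 : DifferentiableAt ℝ (fun z ↦ chrAt G z (b q)) x :=
      differentiableAt_clm_apply_const hΓd _
    have h2 : DifferentiableAt ℝ (fun z ↦ chrAt G z (b q) (b r)) x :=
      differentiableAt_clm_apply_const h1 _
    have h3 : fderiv ℝ (fun z ↦ b.coord i (chrAt G z (b q) (b r))) x =
        (coordCLM b i).comp (fderiv ℝ (fun z ↦ chrAt G z (b q) (b r)) x) :=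
      ((coordCLM b i).hasFDerivAt.comp x h2.hasFDerivAt).fderiv
    rw [h3, ContinuousLinearMap.comp_apply, coordCLM_apply, fderiv_clm_apply_const h1 (b r) (b p),
      fderiv_clm_apply_const hΓd (b q) (b p)]
  -- the quadratic terms: `∑ₘ Γⁱₚₘ Γᵐ_{qj} = eⁱ(Γ(eₚ, Γ(e_q, eⱼ)))`
  have hquad : ∀ p q : Fin d,
      (∑ m, coordChristoffel (metricMatrix G) (ofLp x) i p m *
        coordChristoffel (metricMatrix G) (ofLp x) m q j) =
        b.coord i (chrAt G x (b p) (chrAt G x (b q) (b j))) := by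
    intro p q
    conv_rhs => rw [← b.sum_repr (chrAt G x (b q) (b j))]
    rw [map_sum, map_sum]
    refine Finset.sum_congr rfl fun m _ ↦ ?_
    rw [map_smul, map_smul, smul_eq_mul, coordChristoffel_metricMatrix hG hx,
      coordChristoffel_metricMatrix hG hx, Module.Basis.coord_apply, Module.Basis.coord_apply,
      mul_comm]
  rw [coordRiemannUp, hder, hder, Finset.sum_sub_distrib, hquad, hquad, riemAt_apply]
  simp only [map_add, map_sub]
  abel

/-- **`Rᵢⱼₖₗ = G_x(R_x(eₖ, eₗ)eⱼ, eᵢ)`**: the covariant curvature components of the matrix field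
are the curvature endomorphism of the bilinear-form field paired with the metric (Lee 2018,
(7.7): `Rᵢⱼₖₗ = gᵢₘ Rᵐⱼₖₗ = ⟨R(∂ₖ,∂ₗ)∂ⱼ, ∂ᵢ⟩`). [cite: ONeill1983, Ch. 3, Lemma 3.38] -/
theorem coordRiemann_metricMatrix (hG : IsMetricOn G V) (hx : x ∈ V)
    (i j k l : Fin d) :
    coordRiemann (metricMatrix G) (ofLp x) i j k l =
      G x (riemAt G x (coordBasis d k) (coordBasis d l) (coordBasis d j)) (coordBasis d i) := by
  set b := coordBasis d with hb
  have hs := hG.symm x hx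
  simp only [coordRiemann, metricMatrix_apply, WithLp.toLp_ofLp, coordRiemannUp_metricMatrix hG hx]
  rw [hs]
  conv_rhs => rw [← b.sum_repr (riemAt G x (b k) (b l) (b j))]
  rw [map_sum]
  refine Finset.sum_congr rfl fun m _ ↦ ?_
  rw [map_smul, smul_eq_mul, Module.Basis.coord_apply, mul_comm]

/-! ### The unit field and its covariant derivative -/

/-- The **unit field** `û = (G(Z,Z))^{-1/2} Z` of a vector field `Z` for the bilinear-form field
`G` (junk where `G(Z,Z) ≤ 0`). [cite: Chern1944, (11)] -/
def metricUnitField (G : (𝔼 d) → (𝔼 d) →L[ℝ] (𝔼 d) →L[ℝ] ℝ) (Z : (𝔼 d) → (𝔼 d)) (y : (𝔼 d)) : (𝔼 d) :=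
  (Real.sqrt (G y (Z y) (Z y)))⁻¹ • Z y

/-- Unfolding lemma for `metricUnitField`. [folklore] -/
theorem unitVec_apply (G : (𝔼 d) → (𝔼 d) →L[ℝ] (𝔼 d) →L[ℝ] ℝ) (Z : (𝔼 d) → (𝔼 d)) (y : (𝔼 d)) :
    metricUnitField G Z y = (Real.sqrt (G y (Z y) (Z y)))⁻¹ • Z y := rfl

variable {Z : (𝔼 d) → (𝔼 d)}

/-- **The unit field of the matrix formalism is the transported unit field**:
`unitField g Z̃ (ofLp x) = ofLp (û x)`. [cite: Chern1944, (11)] -/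
theorem unitField_coordField (hs : ∀ v w : (𝔼 d), G x v w = G x w v) :
    unitField (metricMatrix G) (coordField Z) (ofLp x) = ofLp (metricUnitField G Z x) := by
  have hZ : coordField Z (ofLp x) = ofLp (Z x) := by
    funext a; simp
  rw [unitField, hZ, metricNormSq_metricMatrix hs, unitVec_apply, WithLp.ofLp_smul]

/-- The same identity as functions, eventually near `ofLp x`. [cite: Chern1944, (11)] -/
theorem unitField_coordField_eventually (hG : IsMetricOn G V) (hx : x ∈ V) :
    unitField (metricMatrix G) (coordField Z) =ᶠ[𝓝 (ofLp x)] coordField (metricUnitField G Z) := by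
  have hopen : IsOpen ((fun y : Fin d → ℝ ↦ (toLp 2 y : (𝔼 d))) ⁻¹' V) :=
    hG.isOpen.preimage (EuclideanSpace.equiv (Fin d) ℝ).symm.continuous
  filter_upwards [hopen.mem_nhds (show toLp 2 (ofLp x) ∈ V from hx)] with y hy
  have h := unitField_coordField (Z := Z) (hG.symm _ hy)
  rw [WithLp.ofLp_toLp] at h
  rw [h]
  rfl

/-- **The lowered covariant derivative of the unit field**:
`(∇ₖu)ₐ = ∑ⱼ g_{aj}(∂ₖuʲ + Γʲₖₗuˡ) = G_x(∇_{eₖ} û, eₐ)` with `∇_{eₖ} û = covDAt G û x eₖ`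
(O'Neill 1983, Prop. 3.13 for `∇`; Chern 1944, (11) for the forms `ω_{αd}`).
[cite: ONeill1983, Ch. 3, Prop. 3.13] -/
theorem covDerivUnitField_coordField (hG : IsMetricOn G V) (hx : x ∈ V)
    (hu : DifferentiableAt ℝ (metricUnitField G Z) x) (a k : Fin d) :
    covDerivUnitField (metricMatrix G) (coordField Z) (ofLp x) a k =
      G x (covDAt G (metricUnitField G Z) x (coordBasis d k)) (coordBasis d a) := by
  set b := coordBasis d with hb
  have hs := hG.symm x hx
  -- the partial derivatives of the unit field
  have hder : ∀ j : Fin d, coordPartial k (fun y ↦ unitField (metricMatrix G) (coordField Z) y j)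
      (ofLp x) = b.coord j (fderiv ℝ (metricUnitField G Z) x (b k)) := by
    intro j
    have hev : (fun y ↦ unitField (metricMatrix G) (coordField Z) y j) =ᶠ[𝓝 (ofLp x)]
        fun y ↦ b.coord j (metricUnitField G Z (toLp 2 y)) := by
      filter_upwards [unitField_coordField_eventually (Z := Z) hG hx] with y hy
      rw [hy, coordField_apply, stdBasis_coord]
    rw [coordPartial_def, hev.fderiv_eq, ← coordPartial_def,
      coordPartial_comp_toLp (fun z ↦ b.coord j (metricUnitField G Z z)) x k]
    have h3 : fderiv ℝ (fun z ↦ b.coord j (metricUnitField G Z z)) x =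
        (coordCLM b j).comp (fderiv ℝ (metricUnitField G Z) x) :=
      ((coordCLM b j).hasFDerivAt.comp x hu.hasFDerivAt).fderiv
    rw [h3, ContinuousLinearMap.comp_apply, coordCLM_apply]
  -- the Christoffel terms
  have hchr : ∀ j : Fin d, (∑ l, coordChristoffel (metricMatrix G) (ofLp x) j k l *
      unitField (metricMatrix G) (coordField Z) (ofLp x) l) =
      b.coord j (chrAt G x (b k) (metricUnitField G Z x)) := by
    intro j
    conv_rhs => rw [← sum_smul_stdBasis (metricUnitField G Z x)]
    rw [map_sum, map_sum]
    refine Finset.sum_congr rfl fun l _ ↦ ?_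
    rw [map_smul, map_smul, smul_eq_mul, coordChristoffel_metricMatrix hG hx,
      unitField_coordField hs, mul_comm]
  -- assemble: `∑ⱼ g_{aj} eʲ(w) = G(e_a, w) = G(w, e_a)` with `w = ∇_{eₖ} û`
  have hsum : ∀ w : (𝔼 d), (∑ j, metricMatrix G (ofLp x) a j * b.coord j w) = G x w (b a) := by
    intro w
    rw [hs]
    conv_rhs => rw [← b.sum_repr w]
    rw [map_sum]
    refine Finset.sum_congr rfl fun j _ ↦ ?_
    rw [map_smul, smul_eq_mul, metricMatrix_apply, WithLp.toLp_ofLp, Module.Basis.coord_apply,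
      mul_comm]
  simp only [covDerivUnitField, hder, hchr, ← map_add]
  rw [hsum, hG.covDAt_apply_eq hx]

/-! ### The divergence in divergence form -/

/-- **The divergence in the standard basis**: `div Z = ∑ᵢ eⁱ(∇_{eᵢ} Z)`.
[cite: ONeill1983, Ch. 3, p. 86] -/
theorem divAt_eq_sum_coord (Z : (𝔼 d) → (𝔼 d)) (x : (𝔼 d)) :
    divAt G Z x = ∑ i, (coordBasis d).coord i (covDAt G Z x (coordBasis d i)) := by
  rw [divAt_eq, traceCLM_apply, trace_eq_sum_coord (coordBasis d)]
  rfl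

/-- The entries of the matrix field of a metric are smooth on the transported open set.
[folklore] -/
theorem contDiffOn_metricMatrix (hG : IsMetricOn G V) (i j : Fin d) {n : WithTop ℕ∞} (hn : n ≤ ∞) :
    ContDiffOn ℝ n (fun y ↦ metricMatrix G y i j)
      ((fun y : Fin d → ℝ ↦ (toLp 2 y : (𝔼 d))) ⁻¹' V) := by
  have h1 : ContDiffOn ℝ ∞ (fun z : (𝔼 d) ↦ G z (coordBasis d i) (coordBasis d j)) V := by
    have hev1 : ContDiffOn ℝ ∞ (fun z : (𝔼 d) ↦ G z (coordBasis d i)) V :=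
      hG.contDiffOn.clm_apply contDiffOn_const
    exact hev1.clm_apply contDiffOn_const
  have h2 := (h1.of_le hn).comp (EuclideanSpace.equiv (Fin d) ℝ).symm.contDiff.contDiffOn
    (s := (fun y : Fin d → ℝ ↦ (toLp 2 y : (𝔼 d))) ⁻¹' V) (fun y hy ↦ hy)
  exact h2

/-- A positive bilinear-form field has positive definite matrices. [folklore] -/
theorem posDef_metricMatrix (hs : ∀ v w : (𝔼 d), G x v w = G x w v)
    (hpos : ∀ v : (𝔼 d), v ≠ 0 → 0 < G x v v) : (metricMatrix G (ofLp x)).PosDef := by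
  refine Matrix.PosDef.of_dotProduct_mulVec_pos ?_ ?_
  · ext i j
    simp only [Matrix.conjTranspose_apply, star_trivial, metricMatrix_apply, WithLp.toLp_ofLp]
    exact hs _ _
  · intro w hw
    have h := metricNormSq_metricMatrix hs (toLp 2 w)
    simp only [metricNormSq] at h
    rw [star_trivial, h]
    exact hpos _ fun h0 ↦ hw (by rw [← WithLp.ofLp_toLp (p := 2) w, h0]; rfl)

/-- **Packaging**: a metric `G` on `V`, positive definite there, and a vector field `Z` of class
`C²` and nonvanishing on an open `W ⊆ V`, transported to `Fin d → ℝ`, form a `ChernSetting`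
(the hypotheses of `div_chernTransgression_eq_eulerDensity`). [folklore] -/
def chernSettingOf (hG : IsMetricOn G V) (hpos : ∀ y ∈ V, ∀ v : (𝔼 d), v ≠ 0 → 0 < G y v v)
    {W : Set (𝔼 d)} (hW : IsOpen W) (hWV : W ⊆ V) (hZ : ContDiffOn ℝ 2 Z W)
    (hZ0 : ∀ y ∈ W, Z y ≠ 0) : ChernSetting d where
  U := (fun y : Fin d → ℝ ↦ (toLp 2 y : (𝔼 d))) ⁻¹' V
  W := (fun y : Fin d → ℝ ↦ (toLp 2 y : (𝔼 d))) ⁻¹' W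
  g := metricMatrix G
  V := coordField Z
  hU := hG.isOpen.preimage (EuclideanSpace.equiv (Fin d) ℝ).symm.continuous
  hW := hW.preimage (EuclideanSpace.equiv (Fin d) ℝ).symm.continuous
  hWU := fun _ hy ↦ hWV hy
  hg := fun y hy ↦ by
    have h := posDef_metricMatrix (hG.symm _ hy) (hpos _ hy)
    rwa [WithLp.ofLp_toLp] at h
  hgs := fun i j ↦ contDiffOn_metricMatrix hG i j (by norm_cast)
  hV := by
    have h := ((EuclideanSpace.equiv (Fin d) ℝ).contDiff.comp_contDiffOn hZ).comp
      (EuclideanSpace.equiv (Fin d) ℝ).symm.contDiff.contDiffOn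
      (s := (fun y : Fin d → ℝ ↦ (toLp 2 y : (𝔼 d))) ⁻¹' W) (fun y hy ↦ hy)
    exact h
  hV0 := fun y hy h0 ↦ hZ0 _ hy (by
    have : ofLp (Z (toLp 2 y)) = 0 := h0
    apply WithLp.ofLp_injective 2
    rw [WithLp.ofLp_zero]
    exact this)

/-- **Jacobi's formula in the form `∂ₖ √det g = √det g · ∑ₐ Γᵃₖₐ`.** [folklore] -/
theorem coordPartial_sqrt_det (hG : IsMetricOn G V) (hpos : ∀ y ∈ V, ∀ v : (𝔼 d), v ≠ 0 → 0 < G y v v)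
    (hx : x ∈ V) (k : Fin d) :
    coordPartial k (fun y ↦ Real.sqrt (metricMatrix G y).det) (ofLp x) =
      Real.sqrt (metricMatrix G (ofLp x)).det *
        ∑ a, coordChristoffel (metricMatrix G) (ofLp x) a k a := by
  set S := chernSettingOf (Z := fun _ ↦ 0) hG hpos isOpen_empty (empty_subset V) contDiffOn_empty
    (fun _ h ↦ h.elim) with hS
  have hxU : ofLp x ∈ S.U := show toLp 2 (ofLp x) ∈ V from hx
  have hdet := S.det_pos hxU
  have hd : DifferentiableAt ℝ (fun y ↦ (S.g y).det) (ofLp x) :=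
    differentiableAt_of_contDiffOn S.cd_det S.hU hxU (by norm_num)
  have h := coordPartial_sqrt k hd hdet.ne'
  rw [S.coordPartial_det hxU] at h
  change coordPartial k (fun y ↦ Real.sqrt (S.g y).det) (ofLp x) =
    Real.sqrt (S.g (ofLp x)).det * ∑ a, coordChristoffel S.g (ofLp x) a k a
  rw [h, S.sum_Γ_diag hxU]
  have hs : Real.sqrt (S.g (ofLp x)).det ≠ 0 := (Real.sqrt_pos.mpr hdet).ne'
  have hss : Real.sqrt (S.g (ofLp x)).det * Real.sqrt (S.g (ofLp x)).det = (S.g (ofLp x)).det :=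
    Real.mul_self_sqrt hdet.le
  nth_rw 1 [← hss]
  field_simp

/-- **The divergence in divergence form** (Lee 2018, Prop. 2.46): for the density
`ρ = √(det g)` of a positive definite metric and a vector field `Z` differentiable at `x`,
`∑ᵢ ∂ᵢ(ρ Z̃ⁱ)(ofLp x) = ρ(ofLp x) · div_G Z (x)`. [cite: Lee2018, Prop. 2.46] -/
theorem sum_coordPartial_sqrt_det_mul (hG : IsMetricOn G V)
    (hpos : ∀ y ∈ V, ∀ v : (𝔼 d), v ≠ 0 → 0 < G y v v) (hx : x ∈ V)
    (hZ : DifferentiableAt ℝ Z x) :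
    ∑ i, coordPartial i (fun y ↦ Real.sqrt (metricMatrix G y).det * coordField Z y i) (ofLp x) =
      Real.sqrt (metricMatrix G (ofLp x)).det * divAt G Z x := by
  set b := coordBasis d with hb
  set S := chernSettingOf (Z := Z) hG hpos isOpen_empty (empty_subset V) contDiffOn_empty
    (fun _ h ↦ h.elim) with hS
  have hxU : ofLp x ∈ S.U := show toLp 2 (ofLp x) ∈ V from hx
  have hdet := S.det_pos hxU
  have hρd : DifferentiableAt ℝ (fun y ↦ Real.sqrt (metricMatrix G y).det) (ofLp x) :=
    (differentiableAt_of_contDiffOn S.cd_det S.hU hxU (by norm_num)).sqrt hdet.ne'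
  -- the components of `Z` and their partial derivatives
  have hZi : ∀ i, DifferentiableAt ℝ (fun y ↦ coordField Z y i) (ofLp x) := by
    intro i
    have h : (fun y ↦ coordField Z y i) = fun y ↦ b.coord i (Z (toLp 2 y)) := by
      funext y; simp [hb]
    rw [h]
    exact differentiableAt_comp_toLp ((coordCLM b i).differentiableAt.comp x hZ)
  have hZder : ∀ i, coordPartial i (fun y ↦ coordField Z y i) (ofLp x) =
      b.coord i (fderiv ℝ Z x (b i)) := by
    intro i
    have h : (fun y ↦ coordField Z y i) = fun y ↦ b.coord i (Z (toLp 2 y)) := by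
      funext y; simp [hb]
    have h3 : fderiv ℝ (fun z ↦ b.coord i (Z z)) x = (coordCLM b i).comp (fderiv ℝ Z x) :=
      ((coordCLM b i).hasFDerivAt.comp x hZ.hasFDerivAt).fderiv
    rw [h, coordPartial_comp_toLp (fun z ↦ b.coord i (Z z)) x i, h3,
      ContinuousLinearMap.comp_apply, coordCLM_apply]
  -- product rule and Jacobi
  have hprod : ∀ i, coordPartial i (fun y ↦ Real.sqrt (metricMatrix G y).det * coordField Z y i)
      (ofLp x) =
      Real.sqrt (metricMatrix G (ofLp x)).det *
          ((∑ a, coordChristoffel (metricMatrix G) (ofLp x) a i a) * coordField Z (ofLp x) i)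
        + Real.sqrt (metricMatrix G (ofLp x)).det * b.coord i (fderiv ℝ Z x (b i)) := by
    intro i
    rw [coordPartial_mul _ hρd (hZi i), coordPartial_sqrt_det hG hpos hx, hZder]
    ring
  simp only [hprod, Finset.sum_add_distrib, ← Finset.mul_sum]
  -- the Christoffel double sum is `∑ₐ eᵃ(Γ(e_a, Z x))`
  have hchr : (∑ i, (∑ a, coordChristoffel (metricMatrix G) (ofLp x) a i a) * coordField Z (ofLp x) i)
      = ∑ a, b.coord a (chrAt G x (b a) (Z x)) := by
    calc (∑ i, (∑ a, coordChristoffel (metricMatrix G) (ofLp x) a i a) * coordField Z (ofLp x) i)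
        = ∑ a, ∑ i, coordChristoffel (metricMatrix G) (ofLp x) a i a * coordField Z (ofLp x) i := by
          simp only [Finset.sum_mul]
          exact Finset.sum_comm
      _ = ∑ a, b.coord a (chrAt G x (b a) (Z x)) := by
          refine Finset.sum_congr rfl fun a _ ↦ ?_
          conv_rhs => rw [← sum_smul_stdBasis (Z x)]
          rw [map_sum, map_sum]
          refine Finset.sum_congr rfl fun i _ ↦ ?_
          rw [map_smul, map_smul, smul_eq_mul, coordChristoffel_metricMatrix hG hx,
            hG.chrAt_comm hx (b i) (b a), coordField_apply, WithLp.toLp_ofLp, mul_comm]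
  rw [hchr, divAt_eq_sum_coord, ← mul_add, ← Finset.sum_add_distrib]
  congr 1
  refine Finset.sum_congr rfl fun a _ ↦ ?_
  rw [hG.covDAt_apply_eq hx, map_add, add_comm]

end Literature.Geometry.Riemannian

end
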